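import Literature.AlgebraicGeometry.Resolution.CentreBlowupAdaptedOrder
import Mathlib.Algebra.MvPolynomial.PDeriv
import HarnessLib

/-!
# [Cossart–Piltant 2019, Proposition 3.1] in the coordinate-centre model: at a permissible centre of
# the first kind the initial form lives on the centre's variables

[CP19, Prop. 3.1 (p. 31)]: "Let `𝒴` be permissible of the first kind at `x ∈ 𝒴`. Then for any well adapted
coordinates `(u₁,…,u_n;Z)` at `x` such that `I(W) = ({u_j}_{j∈J})`, the initial form `in_{m_S}h ∈ G(m_S)[Z]`
satisfies  `H⁻¹ < G^p, F_{p,Z} > ⊆ k(x)[{U_j}_{j∈J}]_{ε(x)}`."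
(Proof, p. 31: "By (ii) of definition 3.1, we have `ε(x) = ε(y)`. Therefore `H^{-i}F^p_{i,Z}
= cl₀(H_W^{-i}F^p_{i,Z,W}) ⊆ G(m_S)_{iε(x)}` is simply the reduction of `H_W^{-i}F^p_{i,Z,W}` modulo `m̄_S` …")

This file PROVES the proposition in the cell's coordinate-centre model (`CentreBlowupAdaptedOrder`:
`h = Z^q + F(y)`, `G = 0`, constant coefficients, a coordinate centre `C_S`, `J = S`, `J' = Sᶜ`,
`F_{p,Z}` = `initialForm F`, `H = Π_u u^{H_u}` with `H_u` = `PointBlowup.bigH F u`, first kind = the typed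
`IsFirstKind` of Def. 3.1):

* `initialForm_exponent_eq_bigH_of_isFirstKind`: every monomial `y^d` of `F_{p,Z}` has `d_u = H_u` for EVERY
  variable `u ∉ S` — i.e. `H⁻¹F_{p,Z}` involves only the variables `{U_j}_{j ∈ J}` of the centre; in
  particular (`initialForm_exponent_eq_zero_of_isFirstKind`) no non-boundary variable transverse to the
  centre occurs in `F_{p,Z}` at all, and (`pderiv_initialForm_eq_zero_of_isFirstKind`) `∂F_{p,Z}/∂u_t = 0`
  for such `t` — the opposite of the second kind (Prop. 3.3: some `Φ_{j'} ≠ 0`);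
* `initialForm_degIn_eq_of_isFirstKind`: every monomial of `F_{p,Z}` has the least `S`-degree `ord_{C_S} F`
  (the degree bookkeeping `… ⊆ k(x)[U_J]_{ε(x)}`: `H⁻¹y^d` has `U_J`-degree `ord_{C_S}F − Σ_{S∩E} H = ε(y) = ε(x)`);
* `ordZero_eq_of_isFirstKind`: the proof's first line "`ε(x) = ε(y)`" unpacked — `ord₀ F = ord_{C_S} F +
  Σ_{u ∈ exc∖S} H_u`.
The `G`-part of the statement (`i₀(x) = p − 1`) is `0` in the model.

Scope: the MODEL CASE only (our own proof of the cited statement read through the typed Def. 3.1; the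
published proposition is about `h ∈ S[Z]` over an excellent regular local ring in well adapted coordinates,
and uses the minimality of the projected polyhedron, Prop. 2.5, which has no counterpart to prove here).
At `S = univ` (the closed point, always of the first kind when `m(x) = p`: `isFirstKind_univ`) the statement
is empty.  Nothing about resolution in general is asserted.  AI-assisted formalisation (observatory
`pub-rosobs`, unit `pub-rosobs-carver-g25`); quotations from arXiv:1412.0868 (PDF page 31).
-/

noncomputable section

open MvPolynomial Finset

open scoped BigOperators

namespace Literature.AlgebraicGeometry.Resolution

open Literature.AlgebraicGeometry.Resolution.Hauser2010
open Literature.AlgebraicGeometry.Resolution.HauserPerlega2019 (initialForm)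

namespace CentreBlowup

/-! ### 0. Private helpers -/

section Helpers

variable {σ : Type*} {K : Type*} [CommRing K]

/-- `H_i ≤ d_i` for every monomial `y^d` of `F`. [folklore] -/
private theorem bigH_le' {F : MvPolynomial σ K} {d : σ →₀ ℕ} (hd : d ∈ F.support) (i : σ) :
    PointBlowup.bigH F i ≤ d i :=
  Finset.inf_le (f := fun d : σ →₀ ℕ => ((d i : ℕ) : ℕ∞)) hd

/-- For `F ≠ 0`, `H_i` is finite. [folklore] -/
private theorem bigH_eq_toNat' {F : MvPolynomial σ K} (hF : F ≠ 0) (i : σ) :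
    PointBlowup.bigH F i = (((PointBlowup.bigH F i).toNat : ℕ) : ℕ∞) := by
  obtain ⟨d, -, h⟩ := Finset.exists_mem_eq_inf F.support (MvPolynomial.support_nonempty.mpr hF)
    (fun d : σ →₀ ℕ => ((d i : ℕ) : ℕ∞))
  rw [show PointBlowup.bigH F i = ((d i : ℕ) : ℕ∞) from h]
  rfl

/-- For `F ≠ 0`, `ord₀ F` is finite. [folklore] -/
private theorem ordZero_eq_toNat' {F : MvPolynomial σ K} (hF : F ≠ 0) :
    ordZero F = (((ordZero F).toNat : ℕ) : ℕ∞) := by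
  have hne : ordZero F ≠ ⊤ := by
    unfold ordZero
    rw [Ne, MvPowerSeries.order_eq_top_iff, MvPolynomial.coe_eq_zero_iff]
    exact hF
  exact (ENat.coe_toNat hne).symm

/-- Casting a finite sum of finite `H_i`. [folklore] -/
private theorem sum_bigH_eq' {F : MvPolynomial σ K} {H : σ → ℕ}
    (hH : ∀ i, PointBlowup.bigH F i = ((H i : ℕ) : ℕ∞)) (T : Finset σ) :
    ∑ i ∈ T, PointBlowup.bigH F i = ((∑ i ∈ T, H i : ℕ) : ℕ∞) := by
  rw [Nat.cast_sum]
  exact Finset.sum_congr rfl fun i _ => hH i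

/-- A monomial of the initial form is a monomial of `F` of degree `ord₀ F`. [folklore] -/
private theorem mem_support_of_mem_support_initialForm' {F : MvPolynomial σ K} {d : σ →₀ ℕ}
    (hd : d ∈ (initialForm F).support) : d ∈ F.support ∧ d.degree = (ordZero F).toNat := by
  have hc := MvPolynomial.mem_support_iff.mp hd
  unfold HauserPerlega2019.initialForm at hc
  rw [coeff_homogeneousComponent] at hc
  by_cases hdo : d.degree = (ordZero F).toNat
  · rw [if_pos hdo] at hc
    exact ⟨MvPolynomial.mem_support_iff.mpr hc, hdo⟩
  · exact absurd (by rw [if_neg hdo]) hc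

/-- The initial form of `0` has no monomials. [folklore] -/
private theorem ne_zero_of_mem_support_initialForm' {F : MvPolynomial σ K} {d : σ →₀ ℕ}
    (hd : d ∈ (initialForm F).support) : F ≠ 0 := by
  rintro rfl
  unfold HauserPerlega2019.initialForm at hd
  rw [map_zero, MvPolynomial.support_zero] at hd
  exact Finset.notMem_empty d hd

end Helpers

section Model

variable {σ : Type*} {K : Type*} [Field K] [Fintype σ] [DecidableEq σ]

/-- The numbers at a first-kind centre, in `ℕ` (`F ≠ 0`): finite `H`, the least `S`-degree `o_S`, and
"`ε(x) = ε(y)`" unpacked as `ord₀ F = o_S + Σ_{u ∈ exc∖S} H_u`. [folklore] -/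
private theorem firstKind_numbers {q : ℕ} {S : Finset σ} {s : CState σ K} (h1 : IsFirstKind q S s)
    (hF : s.F ≠ 0) :
    ∃ (H : σ → ℕ) (oS : ℕ), (∀ i, PointBlowup.bigH s.F i = ((H i : ℕ) : ℕ∞)) ∧
      ordAlong S s.F = (oS : ℕ∞) ∧ (∀ d ∈ s.F.support, oS ≤ degIn S d ∧ ∀ i, H i ≤ d i) ∧
      (ordZero s.F).toNat = oS + ∑ u ∈ s.exc \ S, H u ∧
      ordZero s.F = (((ordZero s.F).toNat : ℕ) : ℕ∞) := by
  obtain ⟨-, hii⟩ := h1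
  set H : σ → ℕ := fun i => (PointBlowup.bigH s.F i).toNat with hHdef
  have hH : ∀ i, PointBlowup.bigH s.F i = ((H i : ℕ) : ℕ∞) := fun i => bigH_eq_toNat' hF i
  have ho := ordZero_eq_toNat' hF
  have hne : s.F.support.Nonempty := MvPolynomial.support_nonempty.mpr hF
  -- a monomial of least `S`-degree
  obtain ⟨d₀, hd₀, hdeg⟩ :=
    Finset.exists_mem_eq_inf s.F.support hne (fun d : σ →₀ ℕ => (degIn S d : ℕ∞))
  have hoS : ordAlong S s.F = (degIn S d₀ : ℕ∞) := hdeg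
  have hHle : ∀ d ∈ s.F.support, ∀ i, H i ≤ d i := fun d hd i => by
    have h := bigH_le' hd i
    rw [hH i] at h
    exact_mod_cast h
  have hmin : ∀ d ∈ s.F.support, degIn S d₀ ≤ degIn S d := fun d hd => by
    have h : ordAlong S s.F ≤ (degIn S d : ℕ∞) := Finset.inf_le hd
    rw [hoS] at h
    exact_mod_cast h
  -- a monomial of least total degree
  obtain ⟨⟨d₁, hd₁, hdeg₁⟩, -⟩ := (ordZero_eq_nat_iff s.F (ordZero s.F).toNat).mp ho
  have hA : ∑ i ∈ S ∩ s.exc, H i ≤ degIn S d₀ :=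
    le_trans (Finset.sum_le_sum fun i _ => hHle d₀ hd₀ i)
      (Finset.sum_le_sum_of_subset Finset.inter_subset_left)
  have hB : ∑ i ∈ s.exc, H i ≤ (ordZero s.F).toNat := by
    rw [← hdeg₁, Finsupp.degree_eq_sum]
    exact le_trans (Finset.sum_le_sum fun i _ => hHle d₁ (MvPolynomial.mem_support_iff.mpr hd₁) i)
      (Finset.sum_le_sum_of_subset (Finset.subset_univ _))
  have hBAC : ∑ i ∈ S ∩ s.exc, H i + ∑ i ∈ s.exc \ S, H i = ∑ i ∈ s.exc, H i := by
    rw [Finset.inter_comm]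
    exact Finset.sum_inter_add_sum_sdiff s.exc S H
  have hnat : degIn S d₀ - ∑ i ∈ S ∩ s.exc, H i = (ordZero s.F).toNat - ∑ i ∈ s.exc, H i := by
    have h := hii
    unfold epsilonAlong at h
    rw [CState.epsilon_eq, hoS, ho, sum_bigH_eq' hH, sum_bigH_eq' hH, ← ENat.coe_sub,
      ← ENat.coe_sub] at h
    exact_mod_cast h
  refine ⟨H, degIn S d₀, hH, hoS, fun d hd => ⟨hmin d hd, hHle d hd⟩, ?_, ho⟩
  omega

/-! ### 1. "`ε(x) = ε(y)`" unpacked -/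

/-- The first line of the proof of Prop. 3.1 in the model: at a centre of the first kind with `F ≠ 0`,
`ord₀ F = ord_{C_S} F + Σ_{u ∈ exc ∖ S} H_u`. [cite: CossartPiltant2019, Prop. 3.1 (p. 31), proof ("By (ii) … ε(x) = ε(y)")] -/
theorem ordZero_eq_of_isFirstKind {q : ℕ} {S : Finset σ} {s : CState σ K} (h1 : IsFirstKind q S s)
    (hF : s.F ≠ 0) : ordZero s.F = ordAlong S s.F + ∑ u ∈ s.exc \ S, PointBlowup.bigH s.F u := by
  obtain ⟨H, oS, hH, hoS, -, ho, ho'⟩ := firstKind_numbers h1 hF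
  rw [ho', ho, hoS, sum_bigH_eq' hH]
  push_cast
  ring

/-! ### 2. `H⁻¹F_{p,Z} ⊆ k(x)[{U_j}_{j∈J}]_{ε(x)}` -/

/-- The bookkeeping behind Prop. 3.1 in the model: for a monomial `y^d` of `F_{p,Z}` at a first-kind centre,
`Σ_{u ∉ S} d_u = Σ_{u ∈ exc∖S} H_u = Σ_{u ∈ exc∖S} d_u`, `deg_S d = ord_{C_S} F`. [folklore] -/
private theorem firstKind_monomial_numbers {q : ℕ} {S : Finset σ} {s : CState σ K}
    (h1 : IsFirstKind q S s) {d : σ →₀ ℕ} (hd : d ∈ (initialForm s.F).support) :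
    ∃ (H : σ → ℕ) (oS : ℕ), (∀ i, PointBlowup.bigH s.F i = ((H i : ℕ) : ℕ∞)) ∧
      ordAlong S s.F = (oS : ℕ∞) ∧ (∀ i, H i ≤ d i) ∧ degIn S d = oS ∧
      ∑ u ∈ s.exc \ S, H u = ∑ u ∈ s.exc \ S, d u ∧
      ∑ u ∈ Sᶜ \ (s.exc \ S), d u = 0 := by
  have hF := ne_zero_of_mem_support_initialForm' hd
  obtain ⟨H, oS, hH, hoS, hsupp, ho, -⟩ := firstKind_numbers h1 hF
  obtain ⟨hdF, hdego⟩ := mem_support_of_mem_support_initialForm' hd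
  obtain ⟨hmin, hHle⟩ := hsupp d hdF
  have hsum := degIn_add_sum_compl S d
  have hsub : s.exc \ S ⊆ Sᶜ := fun u hu => Finset.mem_compl.mpr (Finset.mem_sdiff.mp hu).2
  have h2' : ∑ u ∈ s.exc \ S, H u ≤ ∑ u ∈ s.exc \ S, d u := Finset.sum_le_sum fun u _ => hHle u
  have hsplit : ∑ u ∈ Sᶜ \ (s.exc \ S), d u + ∑ u ∈ s.exc \ S, d u = ∑ u ∈ Sᶜ, d u :=
    Finset.sum_sdiff hsub
  refine ⟨H, oS, hH, hoS, hHle, ?_, ?_, ?_⟩ <;> omega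

/-- **Prop. 3.1 in the model**: at a permissible centre of the first kind, every monomial `y^d` of the
initial form `F_{p,Z}` has, in EVERY variable `u` off the centre, exactly the exponent `H_u` — so
`H⁻¹F_{p,Z}` is a polynomial in the centre's variables `{U_j}_{j∈J}` alone.
[cite: CossartPiltant2019, Prop. 3.1 (p. 31)] -/
theorem initialForm_exponent_eq_bigH_of_isFirstKind {q : ℕ} {S : Finset σ} {s : CState σ K}
    (h1 : IsFirstKind q S s) :
    ∀ d ∈ (initialForm s.F).support, ∀ u, u ∉ S → ((d u : ℕ) : ℕ∞) = PointBlowup.bigH s.F u := by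
  intro d hd u huS
  obtain ⟨H, oS, hH, -, hHle, -, hE, hrest⟩ := firstKind_monomial_numbers h1 hd
  rw [hH u, Nat.cast_inj]
  by_cases huE : u ∈ s.exc
  · -- termwise equality inside `exc ∖ S`: equal sums of termwise `≤`
    have hu : u ∈ s.exc \ S := Finset.mem_sdiff.mpr ⟨huE, huS⟩
    by_contra hne
    have hlt : H u < d u := lt_of_le_of_ne (hHle u) (Ne.symm hne)
    have := Finset.sum_lt_sum (s := s.exc \ S) (fun v _ => hHle v) ⟨u, hu, hlt⟩
    omega
  · -- outside the boundary nothing is left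
    have hu : u ∈ Sᶜ \ (s.exc \ S) :=
      Finset.mem_sdiff.mpr ⟨Finset.mem_compl.mpr huS, fun h => huE (Finset.mem_sdiff.mp h).1⟩
    have hle : d u ≤ ∑ v ∈ Sᶜ \ (s.exc \ S), d v :=
      Finset.single_le_sum (fun _ _ => Nat.zero_le _) hu
    have hdu : d u = 0 := by omega
    have hHu : H u = 0 := Nat.le_zero.mp (hdu ▸ hHle u)
    rw [hdu, hHu]

/-- In particular NO non-boundary variable transverse to the centre occurs in `F_{p,Z}`.
[cite: CossartPiltant2019, Prop. 3.1 (p. 31)] -/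
theorem initialForm_exponent_eq_zero_of_isFirstKind {q : ℕ} {S : Finset σ} {s : CState σ K}
    (h1 : IsFirstKind q S s) :
    ∀ d ∈ (initialForm s.F).support, ∀ u, u ∉ S → u ∉ s.exc → d u = 0 := by
  intro d hd u huS huE
  obtain ⟨H, oS, -, -, -, -, -, hrest⟩ := firstKind_monomial_numbers h1 hd
  have hu : u ∈ Sᶜ \ (s.exc \ S) :=
    Finset.mem_sdiff.mpr ⟨Finset.mem_compl.mpr huS, fun h => huE (Finset.mem_sdiff.mp h).1⟩
  have hle : d u ≤ ∑ v ∈ Sᶜ \ (s.exc \ S), d v :=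
    Finset.single_le_sum (fun _ _ => Nat.zero_le _) hu
  omega

/-- … and the `S`-degree of every monomial of `F_{p,Z}` is the least one, `ord_{C_S} F` — so `H⁻¹y^d` has
`U_J`-degree `ord_{C_S}F − Σ_{S∩E} H = ε(y) = ε(x)`: "`⊆ k(x)[{U_j}_{j∈J}]_{ε(x)}`".
[cite: CossartPiltant2019, Prop. 3.1 (p. 31)] -/
theorem initialForm_degIn_eq_of_isFirstKind {q : ℕ} {S : Finset σ} {s : CState σ K}
    (h1 : IsFirstKind q S s) :
    ∀ d ∈ (initialForm s.F).support, (degIn S d : ℕ∞) = ordAlong S s.F := by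
  intro d hd
  obtain ⟨H, oS, -, hoS, -, hdeg, -, -⟩ := firstKind_monomial_numbers h1 hd
  rw [hoS, hdeg]

/-- Hence `∂F_{p,Z}/∂u_t = 0` for every non-boundary variable `t` transverse to a first-kind centre — in
contrast with the second kind (Prop. 3.3: `Φ_{j'} ≠ 0` for some `j' ∈ J' ∖ (J')_E`).
[cite: CossartPiltant2019, Prop. 3.1 (p. 31) with Prop. 3.3 (p. 32)] -/
theorem pderiv_initialForm_eq_zero_of_isFirstKind {q : ℕ} {S : Finset σ} {s : CState σ K}
    (h1 : IsFirstKind q S s) {t : σ} (htS : t ∉ S) (htE : t ∉ s.exc) :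
    pderiv t (initialForm s.F) = 0 := by
  apply pderiv_eq_zero_of_notMem_vars
  rw [MvPolynomial.mem_vars_iff_mem_support]
  rintro ⟨d, hd, ht⟩
  exact (Finsupp.mem_support_iff.mp ht)
    (initialForm_exponent_eq_zero_of_isFirstKind h1 d hd t htS htE)

/-- So at a first-kind centre a transverse non-boundary variable never witnesses `V(F_{p,Z},E,m_S) ≠ 0`:
if `V ≠ 0`, the witnessing variable lies on the centre (`j ∈ J ∖ J_E`).
[cite: CossartPiltant2019, Prop. 3.1 (p. 31) with Def. 2.16 (p. 24)] -/
theorem vNonzero_witness_mem_of_isFirstKind {q : ℕ} {S : Finset σ} {s : CState σ K}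
    (h1 : IsFirstKind q S s) (hV : PointBlowup.VNonzero s.exc s.F) :
    ∃ j ∈ S, j ∉ s.exc ∧ pderiv j (initialForm s.F) ≠ 0 := by
  obtain ⟨j, hjE, hj⟩ := hV
  by_cases hjS : j ∈ S
  · exact ⟨j, hjS, hjE, hj⟩
  · exact absurd (pderiv_initialForm_eq_zero_of_isFirstKind h1 hjS hjE) hj

end Model

end CentreBlowup

end Literature.AlgebraicGeometry.Resolution

end
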